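import Mathlib
import Summits.CriticalPhenomena.CardyFormulaZ2.Theorems.CardyMagicRigidityPositiveConeDefs
import HarnessLib

/-!
# Weight doubling, algebraic half: cone law at `t` and at the partner charge `−t − 2π/3`
# imply the nesting density `ν = 1/(2π√3)` (line `positive-cone-weight-doubling`, crux `NestingRigidity`)

Crux `Summit.CriticalPhenomena.CardyFormulaZ2.Theses.CardyMagicRigidity.NestingRigidity`
(stmt-CriticalPhenomena-4835), line `positive-cone-weight-doubling`, registered stub
`stub_weightDoubling : MagicFormulaZ2 → ConeTiltLaw zEns → NestingDensity zEns` (vocabulary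
`Theorems/CardyMagicRigidityPositiveConeDefs.lean`).

THE DIVISION STEP of weight doubling, for a general mesh-indexed ensemble `E`.  Fix a charge `t` in the
positive cone `(−π/6, π/6)` and its partner `t' = −t − 2π/3`; the involution fixes the tower weight
`w(t') = w(t)` (`magicWeight_doubling`) but shifts the Gaussian exponent by
`β(t'² − t²) = (t + π/3)/π` (`exponent_gap`).  IF the single-radius identity
`E_δ[w(t)^{N_0(r,1)}] · exp(√3 τ · E_δ[N_0(r,1)]) = r^{βτ² ± η}` holds at BOTH charges `τ = t`
(`ConeTiltLaw`, the output of `stub_coneScaling`) and `τ = t'` (the partner law — the genuinely missing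
estimate of the stub: it needs signed scale-1 loop factors), then dividing the two identities kills the
unknown tower moment: `exp(√3 (t' − t) E_δ N) = r^{β(t'² − t²) ± 2η}`, i.e.
`E_δ[N_0(r,1)] = (ν ± η') log(1/r)` with `ν = β(t'² − t²)/(√3 (t − t')) = ((t + π/3)/π)/(2√3 (t + π/3))
= 1/(2π√3) = nuSix` and `η' = 2η/(2√3 (t + π/3))`.  This file proves exactly that, as pure real analysis:

* §1 `charge_gap`, `nuSix_mul_charge_gap`, `exponent_gap_eq_nuSix_mul` — the constants at the partner
  charge: `√3 (t − t') = 2√3 (t + π/3) > 0` and `βt'² − βt² = ν · 2√3 (t + π/3)`;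
* §2 `sandwich_core` — the bookkeeping in logarithmic coordinates (linear arithmetic), and
  `meanTower_sandwich_of_two_charges` — the division at one pair `(r, δ)`: from the two sandwiches for
  the numbers `M = E_δ[w^N]` and `m = E_δ N` to `(ν − η') log(1/r) ≤ m ≤ (ν + η') log(1/r)`;
* §3 `nestingDensity_of_partnerLaw` (registered sub-goal) — cone law at `t` + partner law at `t'` ⇒
  `NestingDensity E`; variants `nestingDensity_of_partnerLaw'` (partner law at its own weight
  `w(t')`) and `nestingDensity_of_coneTiltLaw_of_partnerInterval` (`ConeTiltLaw E` + the law on the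
  whole partner interval `(−5π/6, −π/2)`, the shape of the sibling seat's `stub_partnerTilt`);
* §4 `nestingDensity_zEns_of_partnerLaw`, `weightDoubling_of_partnerLaw` — the corollaries in the shape
  of the stub: a partner law for bond-`ℤ²` at ONE cone charge, together with `ConeTiltLaw zEns`, gives
  `NestingDensity zEns`, hence `WeightDoubling`.

Nothing is asserted: the partner law enters as an explicit hypothesis.
-/

noncomputable section

open MeasureTheory Set Filter Metric
open scoped Real Topology BigOperators

namespace Summit.CriticalPhenomena.CardyFormulaZ2.Cruxes.NestingRigidity.PositiveConeWeightDoubling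

open Literature.Probability.RandomPlanarGeometry Literature.Probability.Percolation
  Literature.Probability.LatticeModels
open Summit.CriticalPhenomena.CardyFormulaZ2.Theses.CardyMagicRigidity
open Summit.CriticalPhenomena.CardyFormulaZ2.Cruxes.NestingRigidity.RingCloudTomography

/-! ## §1 The lever's constants at the partner charge -/

/-- The charge gap `√3 (t − t') = 2√3 (t + π/3)` between a charge and its partner. -/
theorem charge_gap (t : ℝ) :
    Real.sqrt 3 * t - Real.sqrt 3 * (-t - 2 * π / 3) = 2 * Real.sqrt 3 * (t + π / 3) := by
  ring

/-- The charge gap is positive on the cone side `t > −π/3`. -/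
theorem charge_gap_pos {t : ℝ} (ht : 0 < t + π / 3) : 0 < 2 * Real.sqrt 3 * (t + π / 3) :=
  mul_pos (mul_pos two_pos (Real.sqrt_pos.2 (by norm_num))) ht

/-- `ν · 2√3 (t + π/3) = (t + π/3)/π`: the density times the charge gap is the exponent gap. -/
theorem nuSix_mul_charge_gap (t : ℝ) :
    nuSix * (2 * Real.sqrt 3 * (t + π / 3)) = (t + π / 3) / π := by
  unfold nuSix
  have hπ : π ≠ 0 := Real.pi_ne_zero
  have h3 : Real.sqrt 3 ≠ 0 := by positivity
  field_simp

/-- **Exponent gap = density × charge gap**: `βt'² − βt² = ν · 2√3 (t + π/3)` (`exponent_gap`). -/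
theorem exponent_gap_eq_nuSix_mul (t : ℝ) :
    beta * (-t - 2 * π / 3) ^ 2 - beta * t ^ 2 = nuSix * (2 * Real.sqrt 3 * (t + π / 3)) := by
  rw [← mul_sub, exponent_gap, nuSix_mul_charge_gap]

/-! ## §2 The division step -/

/-- **Bookkeeping in logarithmic coordinates.** With `ℓ = log r = −L`, `lA = log(M e^{s m})`,
`lB = log(M e^{s' m}) = lA + (s' − s) m`, the two sandwiches `(a ± η) ℓ`, `(a' ± η) ℓ` for `lA`, `lB`,
the gap identities `s − s' = D > 0`, `a' − a = ν D`, `2η = η' D` give `(ν − η') L ≤ m ≤ (ν + η') L`. -/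
theorem sandwich_core {a a' η η' ν ℓ L lA lB s s' D m : ℝ}
    (h1l : (a + η) * ℓ ≤ lA) (h1u : lA ≤ (a - η) * ℓ)
    (h2l : (a' + η) * ℓ ≤ lB) (h2u : lB ≤ (a' - η) * ℓ)
    (hBA : lB = lA + (s' - s) * m) (hD : s - s' = D) (hDpos : 0 < D)
    (hgap : a' - a = ν * D) (hη : 2 * η = η' * D) (hℓ : ℓ = -L) :
    (ν - η') * L ≤ m ∧ m ≤ (ν + η') * L := by
  subst hℓ
  have e1 : a' - a + 2 * η = (ν + η') * D := by linarith
  have e2 : a' - a - 2 * η = (ν - η') * D := by linarith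
  have e3 : s' - s = -D := by linarith
  have hlo : (a' - a + 2 * η) * -L ≤ (s' - s) * m := by linarith
  have hhi : (s' - s) * m ≤ (a' - a - 2 * η) * -L := by linarith
  rw [e1, e3] at hlo
  rw [e2, e3] at hhi
  constructor
  · refine le_of_mul_le_mul_left ?_ hDpos
    linarith
  · refine le_of_mul_le_mul_left ?_ hDpos
    linarith

/-- **The division at one pair `(r, δ)`.** For numbers `M` (the tower moment `E_δ[w(t)^N]`) and `m`
(the mean tower count `E_δ N`), `0 < r`, a charge with `t + π/3 > 0` and `η = η' · √3 (t + π/3)`: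
the sandwiches `r^{βt²+η} ≤ M e^{√3 t m} ≤ r^{βt²−η}` and `r^{βt'²+η} ≤ M e^{√3 t' m} ≤ r^{βt'²−η}`
(`t' = −t − 2π/3`) force `(ν − η') log(1/r) ≤ m ≤ (ν + η') log(1/r)`.  (`M > 0` is a consequence of the
first sandwich since `r^x > 0`; then take logarithms and subtract.) -/
theorem meanTower_sandwich_of_two_charges {r M m t η η' : ℝ} (hr : 0 < r) (ht : 0 < t + π / 3)
    (hη : η = η' * (Real.sqrt 3 * (t + π / 3)))
    (h1 : r ^ (beta * t ^ 2 + η) ≤ M * Real.exp (Real.sqrt 3 * t * m) ∧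
      M * Real.exp (Real.sqrt 3 * t * m) ≤ r ^ (beta * t ^ 2 - η))
    (h2 : r ^ (beta * (-t - 2 * π / 3) ^ 2 + η) ≤
        M * Real.exp (Real.sqrt 3 * (-t - 2 * π / 3) * m) ∧
      M * Real.exp (Real.sqrt 3 * (-t - 2 * π / 3) * m) ≤ r ^ (beta * (-t - 2 * π / 3) ^ 2 - η)) :
    (nuSix - η') * Real.log (1 / r) ≤ m ∧ m ≤ (nuSix + η') * Real.log (1 / r) := by
  have hA : 0 < M * Real.exp (Real.sqrt 3 * t * m) := (Real.rpow_pos_of_pos hr _).trans_le h1.1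
  have hB : 0 < M * Real.exp (Real.sqrt 3 * (-t - 2 * π / 3) * m) :=
    (Real.rpow_pos_of_pos hr _).trans_le h2.1
  have h1l := Real.log_le_log (Real.rpow_pos_of_pos hr _) h1.1
  have h1u := Real.log_le_log hA h1.2
  have h2l := Real.log_le_log (Real.rpow_pos_of_pos hr _) h2.1
  have h2u := Real.log_le_log hB h2.2
  rw [Real.log_rpow hr] at h1l h1u h2l h2u
  have hprod : M * Real.exp (Real.sqrt 3 * (-t - 2 * π / 3) * m) =
      M * Real.exp (Real.sqrt 3 * t * m) *
        Real.exp ((Real.sqrt 3 * (-t - 2 * π / 3) - Real.sqrt 3 * t) * m) := by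
    have e : Real.sqrt 3 * (-t - 2 * π / 3) * m =
        Real.sqrt 3 * t * m + (Real.sqrt 3 * (-t - 2 * π / 3) - Real.sqrt 3 * t) * m := by ring
    rw [e, Real.exp_add]
    ring
  have hBA : Real.log (M * Real.exp (Real.sqrt 3 * (-t - 2 * π / 3) * m)) =
      Real.log (M * Real.exp (Real.sqrt 3 * t * m)) +
        (Real.sqrt 3 * (-t - 2 * π / 3) - Real.sqrt 3 * t) * m := by
    rw [hprod, Real.log_mul hA.ne' (Real.exp_pos _).ne', Real.log_exp]
  have hη2 : 2 * η = η' * (2 * Real.sqrt 3 * (t + π / 3)) := by rw [hη]; ring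
  have hℓ : Real.log r = -Real.log (1 / r) := by rw [one_div, Real.log_inv, neg_neg]
  exact sandwich_core h1l h1u h2l h2u hBA (charge_gap t) (charge_gap_pos ht)
    (exponent_gap_eq_nuSix_mul t) hη2 hℓ

/-! ## §3 Cone law + partner law ⇒ nesting density -/

/-- **Weight doubling, algebraic half** (registered sub-goal of `stub_weightDoubling`). For a general
mesh-indexed ensemble `E` and ONE charge `t` in the positive cone `(−π/6, π/6)`: if the self-consistent
single-radius identity `r^{βτ²+η} ≤ E_δ[w(t)^{N_0(r,1)}] · exp(√3 τ E_δ[N_0(r,1)]) ≤ r^{βτ²−η}` holds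
(every `η > 0`, small `r`, then small `δ`) both at `τ = t` (the cone law) and at the partner charge
`τ = t' = −t − 2π/3` (same tower weight, `magicWeight_doubling`), then `E` has the nesting density
`ν = nuSix = 1/(2π√3)`: `(ν − η) log(1/r) ≤ E_δ[N_0(r,1)] ≤ (ν + η) log(1/r)`.  Proof: for the goal's
`η'` run both hypotheses at `η = η' √3 (t + π/3)`, intersect the two eventualities and divide
(`meanTower_sandwich_of_two_charges`). -/
theorem nestingDensity_of_partnerLaw : ∀ (E : LoopEnsemble) {t : ℝ}, t ∈ Set.Ioo (-(π / 6)) (π / 6) →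
    (∀ η : ℝ, 0 < η → ∃ r₀ : ℝ, 0 < r₀ ∧ ∀ r ∈ Set.Ioo (0 : ℝ) r₀, ∀ᶠ δ in 𝓝[>] (0 : ℝ),
      r ^ (beta * t ^ 2 + η) ≤
          E.towerMoment (magicWeight t) δ r * Real.exp (Real.sqrt 3 * t * meanTower E δ r) ∧
        E.towerMoment (magicWeight t) δ r * Real.exp (Real.sqrt 3 * t * meanTower E δ r) ≤
          r ^ (beta * t ^ 2 - η)) →
    (∀ η : ℝ, 0 < η → ∃ r₀ : ℝ, 0 < r₀ ∧ ∀ r ∈ Set.Ioo (0 : ℝ) r₀, ∀ᶠ δ in 𝓝[>] (0 : ℝ),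
      r ^ (beta * (-t - 2 * π / 3) ^ 2 + η) ≤
          E.towerMoment (magicWeight t) δ r *
            Real.exp (Real.sqrt 3 * (-t - 2 * π / 3) * meanTower E δ r) ∧
        E.towerMoment (magicWeight t) δ r *
            Real.exp (Real.sqrt 3 * (-t - 2 * π / 3) * meanTower E δ r) ≤
          r ^ (beta * (-t - 2 * π / 3) ^ 2 - η)) →
    NestingDensity E := by
  intro E t ht hcone hpartner η' hη'
  have ht3 : 0 < t + π / 3 := by linarith [ht.1, Real.pi_pos]
  have hηpos : 0 < η' * (Real.sqrt 3 * (t + π / 3)) :=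
    mul_pos hη' (mul_pos (Real.sqrt_pos.2 (by norm_num)) ht3)
  obtain ⟨r₁, hr₁, h₁⟩ := hcone _ hηpos
  obtain ⟨r₂, hr₂, h₂⟩ := hpartner _ hηpos
  refine ⟨min r₁ r₂, lt_min hr₁ hr₂, fun r hr ↦ ?_⟩
  filter_upwards [h₁ r ⟨hr.1, hr.2.trans_le (min_le_left _ _)⟩,
    h₂ r ⟨hr.1, hr.2.trans_le (min_le_right _ _)⟩] with δ hδ₁ hδ₂
  exact meanTower_sandwich_of_two_charges hr.1 ht3 rfl hδ₁ hδ₂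

/-- The same statement with the partner law written at the partner's own tower weight
`magicWeight (−t − 2π/3)` (equal to `magicWeight t` by `magicWeight_doubling`). -/
theorem nestingDensity_of_partnerLaw' (E : LoopEnsemble) {t : ℝ} (ht : t ∈ Set.Ioo (-(π / 6)) (π / 6))
    (hcone : ∀ η : ℝ, 0 < η → ∃ r₀ : ℝ, 0 < r₀ ∧ ∀ r ∈ Set.Ioo (0 : ℝ) r₀, ∀ᶠ δ in 𝓝[>] (0 : ℝ),
      r ^ (beta * t ^ 2 + η) ≤
          E.towerMoment (magicWeight t) δ r * Real.exp (Real.sqrt 3 * t * meanTower E δ r) ∧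
        E.towerMoment (magicWeight t) δ r * Real.exp (Real.sqrt 3 * t * meanTower E δ r) ≤
          r ^ (beta * t ^ 2 - η))
    (hpartner : ∀ η : ℝ, 0 < η → ∃ r₀ : ℝ, 0 < r₀ ∧ ∀ r ∈ Set.Ioo (0 : ℝ) r₀, ∀ᶠ δ in 𝓝[>] (0 : ℝ),
      r ^ (beta * (-t - 2 * π / 3) ^ 2 + η) ≤
          E.towerMoment (magicWeight (-t - 2 * π / 3)) δ r *
            Real.exp (Real.sqrt 3 * (-t - 2 * π / 3) * meanTower E δ r) ∧
        E.towerMoment (magicWeight (-t - 2 * π / 3)) δ r *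
            Real.exp (Real.sqrt 3 * (-t - 2 * π / 3) * meanTower E δ r) ≤
          r ^ (beta * (-t - 2 * π / 3) ^ 2 - η)) :
    NestingDensity E := by
  rw [magicWeight_doubling] at hpartner
  exact nestingDensity_of_partnerLaw E ht hcone hpartner

/-- **Cone law + partner-interval law ⇒ density.** If the single-radius identity holds on the cone
`(−π/6, π/6)` (`ConeTiltLaw E`) and on the partner interval `(−5π/6, −π/2)` (the shape registered by
the sibling seat as `stub_partnerTilt`), then `E` has nesting density `ν`: run the division at the
pair `t = 0`, `t' = −2π/3`. -/
theorem nestingDensity_of_coneTiltLaw_of_partnerInterval (E : LoopEnsemble) (hC : ConeTiltLaw E)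
    (hP : ∀ t ∈ Set.Ioo (-(5 * π / 6)) (-(π / 2)), ∀ η : ℝ, 0 < η → ∃ r₀ : ℝ, 0 < r₀ ∧
      ∀ r ∈ Set.Ioo (0 : ℝ) r₀, ∀ᶠ δ in 𝓝[>] (0 : ℝ),
        r ^ (beta * t ^ 2 + η) ≤
            E.towerMoment (magicWeight t) δ r * Real.exp (Real.sqrt 3 * t * meanTower E δ r) ∧
          E.towerMoment (magicWeight t) δ r * Real.exp (Real.sqrt 3 * t * meanTower E δ r) ≤
            r ^ (beta * t ^ 2 - η)) :
    NestingDensity E := by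
  have h0 : (0 : ℝ) ∈ Set.Ioo (-(π / 6)) (π / 6) := by
    constructor <;> linarith [Real.pi_pos]
  have h0' : (-0 - 2 * π / 3 : ℝ) ∈ Set.Ioo (-(5 * π / 6)) (-(π / 2)) := by
    constructor <;> linarith [Real.pi_pos]
  exact nestingDensity_of_partnerLaw' E h0 (hC 0 h0) (hP _ h0')

/-! ## §4 The corollaries in the shape of the stub -/

/-- **Bond-`ℤ²`**: a partner law for `zEns` at ONE cone charge, together with the cone law
`ConeTiltLaw zEns` (output of `stub_coneScaling`), gives the nesting density of bond-`ℤ²`. -/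
theorem nestingDensity_zEns_of_partnerLaw
    (hP : ∃ t ∈ Set.Ioo (-(π / 6)) (π / 6), ∀ η : ℝ, 0 < η → ∃ r₀ : ℝ, 0 < r₀ ∧
      ∀ r ∈ Set.Ioo (0 : ℝ) r₀, ∀ᶠ δ in 𝓝[>] (0 : ℝ),
        r ^ (beta * (-t - 2 * π / 3) ^ 2 + η) ≤
            zEns.towerMoment (magicWeight t) δ r *
              Real.exp (Real.sqrt 3 * (-t - 2 * π / 3) * meanTower zEns δ r) ∧
          zEns.towerMoment (magicWeight t) δ r *
              Real.exp (Real.sqrt 3 * (-t - 2 * π / 3) * meanTower zEns δ r) ≤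
            r ^ (beta * (-t - 2 * π / 3) ^ 2 - η))
    (hC : ConeTiltLaw zEns) : NestingDensity zEns := by
  obtain ⟨t, ht, hpartner⟩ := hP
  exact nestingDensity_of_partnerLaw zEns ht (hC t ht) hpartner

/-- **`WeightDoubling` from the partner law**: if `MagicFormulaZ2` yields the partner-charge
single-radius identity for bond-`ℤ²` at some cone charge (the stub's missing signed-scale-1-factor
estimate), then `WeightDoubling` (`= MagicFormulaZ2 → ConeTiltLaw zEns → NestingDensity zEns`) holds. -/
theorem weightDoubling_of_partnerLaw : (MagicFormulaZ2 → ∃ t ∈ Set.Ioo (-(π / 6)) (π / 6), ∀ η : ℝ,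
    0 < η → ∃ r₀ : ℝ, 0 < r₀ ∧ ∀ r ∈ Set.Ioo (0 : ℝ) r₀, ∀ᶠ δ in 𝓝[>] (0 : ℝ),
      r ^ (beta * (-t - 2 * π / 3) ^ 2 + η) ≤
          zEns.towerMoment (magicWeight t) δ r *
            Real.exp (Real.sqrt 3 * (-t - 2 * π / 3) * meanTower zEns δ r) ∧
        zEns.towerMoment (magicWeight t) δ r *
            Real.exp (Real.sqrt 3 * (-t - 2 * π / 3) * meanTower zEns δ r) ≤
          r ^ (beta * (-t - 2 * π / 3) ^ 2 - η)) → WeightDoubling :=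
  fun hP hZ hC ↦ nestingDensity_zEns_of_partnerLaw (hP hZ) hC

end Summit.CriticalPhenomena.CardyFormulaZ2.Cruxes.NestingRigidity.PositiveConeWeightDoubling

end
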